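import Literature.Probability.RandomPlanarGeometry.PlusHullKoebe
import Literature.Probability.RandomPlanarGeometry.RestrictionDensity
import Literature.Analysis.Complex.Montel
import HarnessLib

/-!
# Convergence near `0` is automatic in [LSW] Lemma 3.5 (Vitali's theorem with uniform Koebe bounds)

G. F. Lawler, O. Schramm, W. Werner, *Conformal restriction: the chordal case*, J. Amer. Math.
Soc. **16** (2003) 917–955, arXiv:math/0209343 (**[LSW]**), proof of Lemma 3.5, p. 12: the
convergence `A_n → A` is "`Φ_{A_n} → Φ_A` uniformly on compact subsets of `ℍ̄ ∖ A` and `⋃ A_n`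
bounded away from `0` and `∞`" ("the maps may be extended to a neighborhood of `0` by Schwarz
reflection"). The tree's transcription `LSWConverges` (`RestrictionDensity`) asks, besides the
annulus clause (i) and the convergence on compacts of the OPEN set `ℍ ∖ A` (ii), for uniform
convergence on a half-disc about the marked boundary point `0` (iii). This proof-only file
shows that for `+`-hulls (iii) follows from (i) and (ii) — indeed from (i) and mere pointwise
convergence near `0`:

* `tendstoLocallyUniformlyOn_of_eventually_tendsto_of_norm_le` — **Vitali's theorem**
  (uniformly bounded case): a uniformly bounded sequence of holomorphic functions on a connected
  open set converging pointwise near one point to a holomorphic `f` converges to `f` locally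
  uniformly (Montel's theorem `Complex.exists_strictMono_tendstoLocallyUniformlyOn_of_norm_le` of
  the tree plus the identity theorem);
* `IsPlusHull.tendstoUniformlyOn_ball_of_tendsto` — for nonempty `A, B_k ∈ 𝒬₊` in a fixed annulus
  `{δ ≤ |z| ≤ 1/δ}` whose restriction maps converge pointwise on `ℍ ∩ B(0, δ)`, the convergence
  is uniform on `ℍ ∩ B(0, δ/2)`: the Schwarz-reflection extensions `E_{B_k}` are holomorphic on
  `B(0, δ)` and bounded there by `8/δ` uniformly in `k` (Koebe at `∞`, `PlusHullKoebe`);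
* `IsPlusHull.lswConverges_of_forall_isCompact` — `LSWConverges` from clauses (i) and (ii) alone.
-/

noncomputable section

open Set Filter Metric Bornology Complex
open _root_.Topology
open UpperHalfPlane (upperHalfPlaneSet isOpen_upperHalfPlaneSet)

namespace Literature.Probability.RandomPlanarGeometry

/-! ### Vitali's theorem, uniformly bounded case -/

/-- **Vitali's convergence theorem** (uniformly bounded case; Montel + identity theorem): let
`F_n` be holomorphic on a connected open `U ⊆ ℂ` with `‖F_n‖ ≤ M` on `U`, `f` holomorphic on
`U`, and `F_n(z) → f(z)` for all `z` near some `z₀ ∈ U`. Then `F_n → f` locally uniformly on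
`U`. (Every subsequence has, by Montel's theorem, a locally uniformly convergent subsequence,
whose holomorphic limit agrees with `f` near `z₀`, hence on `U`.) [folklore] -/
theorem tendstoLocallyUniformlyOn_of_eventually_tendsto_of_norm_le {U : Set ℂ} (hU : IsOpen U)
    (hUc : IsPreconnected U) {F : ℕ → ℂ → ℂ} {f : ℂ → ℂ} {M : ℝ}
    (hF : ∀ n, DifferentiableOn ℂ (F n) U) (hM : ∀ n, ∀ z ∈ U, ‖F n z‖ ≤ M)
    (hf : DifferentiableOn ℂ f U) {z₀ : ℂ} (hz₀ : z₀ ∈ U)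
    (hpt : ∀ᶠ z in 𝓝 z₀, Tendsto (fun n ↦ F n z) atTop (𝓝 (f z))) :
    TendstoLocallyUniformlyOn F f atTop U := by
  rw [tendstoLocallyUniformlyOn_iff_forall_isCompact hU]
  intro K hKU hK
  rw [Metric.tendstoUniformlyOn_iff]
  intro ε hε
  by_contra hnot
  have hfr : ∃ᶠ n in atTop, ∃ z ∈ K, ε ≤ dist (f z) (F n z) := by
    rw [not_eventually] at hnot
    refine hnot.mono fun n hn ↦ ?_
    by_contra h
    push Not at h
    exact hn fun z hz ↦ h z hz
  obtain ⟨φ, hφ, hφP⟩ := extraction_of_frequently_atTop hfr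
  obtain ⟨g, ψ, hψ, hgd, hconv, -⟩ :=
    Complex.exists_strictMono_tendstoLocallyUniformlyOn_of_norm_le hU (fun n ↦ hF (φ n))
      (fun n z hz ↦ hM (φ n) z hz)
  -- the limit `g` agrees with `f` near `z₀`, hence on `U`
  have hfg : f =ᶠ[𝓝 z₀] g := by
    filter_upwards [hpt, hU.mem_nhds hz₀] with z hz hzU
    have h1 : Tendsto (fun n ↦ F (φ (ψ n)) z) atTop (𝓝 (g z)) := hconv.tendsto_at hzU
    have h2 : Tendsto (fun n ↦ F (φ (ψ n)) z) atTop (𝓝 (f z)) :=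
      hz.comp ((hφ.comp hψ).tendsto_atTop)
    exact tendsto_nhds_unique h2 h1
  have heq : EqOn f g U :=
    AnalyticOnNhd.eqOn_of_preconnected_of_eventuallyEq
      ((Complex.analyticOnNhd_iff_differentiableOn hU).2 hf)
      ((Complex.analyticOnNhd_iff_differentiableOn hU).2 hgd) hUc hz₀ hfg
  -- but along `φ ∘ ψ` some point of `K` stays `ε`-far from `f = g`
  have hK' := (tendstoLocallyUniformlyOn_iff_forall_isCompact hU).1 hconv K hKU hK
  rw [Metric.tendstoUniformlyOn_iff] at hK'
  obtain ⟨N, hN⟩ := (hK' ε hε).exists_forall_of_atTop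
  obtain ⟨z, hzK, hz⟩ := hφP (ψ N)
  have h1 := hN N le_rfl z hzK
  rw [← heq (hKU hzK)] at h1
  linarith

/-! ### Near `0`, convergence of restriction maps of `+`-hulls in an annulus is uniform -/

section NearZero

variable {A : Set ℂ} {Φ : ConformalEquiv (upperHalfPlaneSet \ A) upperHalfPlaneSet}
  {B : ℕ → Set ℂ} {Θ : ∀ k, ConformalEquiv (upperHalfPlaneSet \ B k) upperHalfPlaneSet}

/-- The annulus `{δ ≤ |z| ≤ 1/δ}` is nonempty only if `δ ≤ 1`. [folklore] -/
theorem le_one_of_mem_annulus {δ : ℝ} {z : ℂ} (hz : δ ≤ ‖z‖ ∧ ‖z‖ ≤ δ⁻¹) : δ ≤ 1 := by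
  by_contra h
  rw [not_le] at h
  have h1 : δ⁻¹ < 1 := inv_lt_one_of_one_lt₀ h
  linarith [hz.1.trans hz.2]

/-- **Uniform convergence near `0` from pointwise convergence**: for nonempty `A, B_k ∈ 𝒬₊` in the
annulus `{δ ≤ |z| ≤ 1/δ}`, if the restriction maps `Θ_k` of `B_k` converge pointwise to the
restriction map `Φ` of `A` on `ℍ ∩ B(0, δ)`, they converge uniformly on `ℍ ∩ B(0, δ/2)`
(Vitali's theorem for the Schwarz-reflection extensions on `B(0, δ)`, bounded by `8/δ` by
Koebe's theorem at `∞`, `IsPlusHull.norm_extMap_le`). [cite: LawlerSchrammWerner2003Restriction, proof of Lemma 3.5 (p. 12), "extended to a neighborhood of 0 by Schwarz reflection"] -/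
theorem IsPlusHull.tendstoUniformlyOn_ball_of_tendsto (hA : IsPlusHull A) (hne : A.Nonempty)
    (hΦ : IsRestrictionMap A Φ) (hB : ∀ k, IsPlusHull (B k)) (hBne : ∀ k, (B k).Nonempty)
    (hΘ : ∀ k, IsRestrictionMap (B k) (Θ k)) {δ : ℝ} (hδ : 0 < δ)
    (hAδ : A ⊆ {z : ℂ | δ ≤ ‖z‖ ∧ ‖z‖ ≤ δ⁻¹}) (hBδ : ∀ k, B k ⊆ {z : ℂ | δ ≤ ‖z‖ ∧ ‖z‖ ≤ δ⁻¹})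
    (hconv : ∀ z ∈ upperHalfPlaneSet, ‖z‖ < δ → Tendsto (fun k ↦ Θ k z) atTop (𝓝 (Φ z))) :
    TendstoUniformlyOn (fun k ↦ (Θ k : ℂ → ℂ)) Φ atTop (upperHalfPlaneSet ∩ ball 0 (δ / 2)) := by
  obtain ⟨a, ha⟩ := hne
  have hδ1 : δ ≤ 1 := le_one_of_mem_annulus (hAδ ha)
  set E : ℕ → ℂ → ℂ := fun k ↦ (hB k).extMap (hBne k) with hE
  set E₀ : ℂ → ℂ := hA.extMap ⟨a, ha⟩ with hE₀
  have hU : IsOpen (ball (0 : ℂ) δ) := isOpen_ball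
  have hUc : IsPreconnected (ball (0 : ℂ) δ) := (convex_ball 0 δ).isPreconnected
  have hsubk : ∀ k, ball (0 : ℂ) δ ⊆ plusDomain (B k) := fun k ↦
    (hB k).ball_subset_plusDomain (hBne k) fun z hz ↦ ((hBδ k) hz).1
  have hsub₀ : ball (0 : ℂ) δ ⊆ plusDomain A :=
    hA.ball_subset_plusDomain ⟨a, ha⟩ fun z hz ↦ (hAδ hz).1
  have hEd : ∀ k, DifferentiableOn ℂ (E k) (ball 0 δ) := fun k ↦
    ((hB k).differentiableOn_extMap (hBne k)).mono (hsubk k)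
  have hE₀d : DifferentiableOn ℂ E₀ (ball 0 δ) := (hA.differentiableOn_extMap ⟨a, ha⟩).mono hsub₀
  have hEM : ∀ k, ∀ z ∈ ball (0 : ℂ) δ, ‖E k z‖ ≤ 8 / δ := fun k z hz ↦
    (hB k).norm_extMap_le (hBne k) hδ (fun w hw ↦ ((hBδ k) hw).2) (hsubk k hz)
      ((mem_ball_zero_iff.1 hz).le.trans (hδ1.trans (by rw [le_div_iff₀ hδ]; nlinarith)))
  -- the extensions agree with the restriction maps on `ℍ ∩ B(0, δ)`
  have hEq : ∀ k, ∀ z ∈ upperHalfPlaneSet ∩ ball (0 : ℂ) δ, E k z = Θ k z := fun k z hz ↦ by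
    have hzB : z ∈ upperHalfPlaneSet \ B k :=
      ⟨hz.1, fun h ↦ by have := ((hBδ k) h).1; linarith [mem_ball_zero_iff.1 hz.2]⟩
    rw [hE]
    simp only
    rw [(hB k).extMap_of_mem_diff (hBne k) hzB, ← (hB k).eqOn_baseMap (hBne k) (hΘ k) hzB]
  have hEq₀ : ∀ z ∈ upperHalfPlaneSet ∩ ball (0 : ℂ) δ, E₀ z = Φ z := fun z hz ↦ by
    have hzA : z ∈ upperHalfPlaneSet \ A :=
      ⟨hz.1, fun h ↦ by have := (hAδ h).1; linarith [mem_ball_zero_iff.1 hz.2]⟩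
    rw [hE₀, hA.extMap_of_mem_diff ⟨a, ha⟩ hzA, ← hA.eqOn_baseMap ⟨a, ha⟩ hΦ hzA]
  -- pointwise convergence near `z₀ = iδ/2`
  set z₀ : ℂ := I * ((δ / 2 : ℝ) : ℂ) with hz₀
  have hz₀H : z₀ ∈ upperHalfPlaneSet := by
    show 0 < z₀.im; simp [hz₀]; positivity
  have hz₀n : ‖z₀‖ < δ := by
    rw [hz₀, norm_mul, Complex.norm_I, one_mul, Complex.norm_real, Real.norm_eq_abs,
      abs_of_pos (by positivity)]
    linarith
  have hz₀U : z₀ ∈ ball (0 : ℂ) δ := mem_ball_zero_iff.2 hz₀n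
  have hpt : ∀ᶠ z in 𝓝 z₀, Tendsto (fun k ↦ E k z) atTop (𝓝 (E₀ z)) := by
    have hopen : IsOpen (upperHalfPlaneSet ∩ ball (0 : ℂ) δ) := isOpen_upperHalfPlaneSet.inter isOpen_ball
    filter_upwards [hopen.mem_nhds ⟨hz₀H, hz₀U⟩] with z hz
    rw [hEq₀ z hz]
    refine (hconv z hz.1 (mem_ball_zero_iff.1 hz.2)).congr fun k ↦ (hEq k z hz).symm
  have hloc := tendstoLocallyUniformlyOn_of_eventually_tendsto_of_norm_le hU hUc hEd hEM hE₀d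
    hz₀U hpt
  -- uniform on the compact `B̄(0, δ/2) ⊆ B(0, δ)`, hence on `ℍ ∩ B(0, δ/2)`
  have hcpt : IsCompact (closedBall (0 : ℂ) (δ / 2)) := isCompact_closedBall _ _
  have hsub : closedBall (0 : ℂ) (δ / 2) ⊆ ball 0 δ := closedBall_subset_ball (by linarith)
  have hunif := (tendstoLocallyUniformlyOn_iff_forall_isCompact hU).1 hloc _ hsub hcpt
  have hunif' := hunif.mono (show upperHalfPlaneSet ∩ ball (0 : ℂ) (δ / 2) ⊆ closedBall 0 (δ / 2) from
    fun z hz ↦ ball_subset_closedBall hz.2)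
  have hsub' : upperHalfPlaneSet ∩ ball (0 : ℂ) (δ / 2) ⊆ upperHalfPlaneSet ∩ ball 0 δ :=
    inter_subset_inter_right _ (ball_subset_ball (by linarith))
  refine (hunif'.congr (Eventually.of_forall fun k z hz ↦ hEq k z (hsub' hz))).congr_right ?_
  exact fun z hz ↦ hEq₀ z (hsub' hz)

/-- **`LSWConverges` from its clauses (i) and (ii)** for nonempty `+`-hulls: the convergence on
a half-disc about `0` (clause (iii)) is automatic (`tendstoUniformlyOn_ball_of_tendsto`), given
a common annulus for `A` and the `B_k`. [cite: LawlerSchrammWerner2003Restriction, proof of Lemma 3.5 (p. 12), the convergence notion] -/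
theorem IsPlusHull.lswConverges_of_forall_isCompact (hA : IsPlusHull A) (hne : A.Nonempty)
    (hΦ : IsRestrictionMap A Φ) (hB : ∀ k, IsPlusHull (B k)) (hBne : ∀ k, (B k).Nonempty)
    (hΘ : ∀ k, IsRestrictionMap (B k) (Θ k)) {δ : ℝ} (hδ : 0 < δ)
    (hAδ : A ⊆ {z : ℂ | δ ≤ ‖z‖ ∧ ‖z‖ ≤ δ⁻¹}) (hBδ : ∀ k, B k ⊆ {z : ℂ | δ ≤ ‖z‖ ∧ ‖z‖ ≤ δ⁻¹})
    (hii : ∀ S : Set ℂ, IsCompact S → S ⊆ upperHalfPlaneSet \ A →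
      (∀ᶠ k in atTop, Disjoint S (B k)) ∧ TendstoUniformlyOn (fun k ↦ (Θ k : ℂ → ℂ)) Φ atTop S) :
    LSWConverges A Φ B Θ := by
  refine ⟨⟨δ, hδ, hBδ⟩, hii, δ / 2, by positivity, ?_⟩
  refine hA.tendstoUniformlyOn_ball_of_tendsto hne hΦ hB hBne hΘ hδ hAδ hBδ fun z hz hzδ ↦ ?_
  have hzA : z ∈ upperHalfPlaneSet \ A := ⟨hz, fun h ↦ by linarith [(hAδ h).1]⟩
  exact ((hii {z} isCompact_singleton (singleton_subset_iff.2 hzA)).2).tendsto_at (mem_singleton z)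

end NearZero

end Literature.Probability.RandomPlanarGeometry

end
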